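import Summits.CriticalPhenomena.SAWScalingLimit.Theorems.SAWTotalPositivityCriticalBubbleBoundDockingReduction

/-!
# Line `docking-census-joining` (crux stmt-CriticalPhenomena-7117): the TRIVIAL pinch-rarity exponent `π = -1`

Sanity sibling of the open conjecture `Docking.PinchRarity (1/2)` (stub S3 of the line): the shape
`PinchRarity π` holds at `π = -1` for the trivial reason that a rooted polygon of size `n < 2^{i+2}` has at
most `n + 1` pinch plaquettes (their lower-left corners are vertices of the walk), so
`pinchMass i ≤ 4 · 2^{i} · R_{i+1}`. This certifies that the conjecture def is correctly oriented and
non-degenerate (constants `C = 4`, `b = 0`); the content of S3 is the gain of `3/2` in the exponent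
(from `-1` to `1/2`), for which no tool exists in print (Hammond 2018, Prop. 4.5 gives `π = 0` for
GLOBAL join plaquettes only).
-/

noncomputable section

open Literature.Probability.LatticeModels
open Literature.Probability.RandomPlanarGeometry Literature.Probability.RandomPlanarGeometry.SAW
open scoped BigOperators
open Summit.CriticalPhenomena.SAWScalingLimit.Theorems.CriticalBubbleBound.Negative (e₀)

namespace Summit.CriticalPhenomena.SAWScalingLimit.Theorems.CriticalBubbleBound.Docking

/-- A rooted polygon of size `n` has at most `n + 1` pinch plaquettes at any scale (their corners are
among the `n + 1` vertices `χ 0, …, χ n`). [folklore] -/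
theorem card_pinches_le (i n : ℕ) (χ : ℕ → Site 2) : (pinches i n χ).card ≤ n + 1 := by
  classical
  calc (pinches i n χ).card ≤ (verts n χ).card := Finset.card_filter_le _ _
    _ ≤ (Finset.range (n + 1)).card := Finset.card_image_le
    _ = n + 1 := Finset.card_range _

/-- The pinch mass at scale `i` is at most `2^{i+2}` times the block mass `R_{i+1}`. [folklore] -/
theorem pinchMass_le_pow_mul_blockMass (i : ℕ) :
    pinchMass i ≤ (2 : ℝ) ^ (i + 2) * blockMass term (i + 1) := by
  classical
  have hx : 0 ≤ criticalFugacity := criticalFugacity_pos_lt_one'.1.le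
  rw [pinchMass, blockMass, Finset.mul_sum]
  refine Finset.sum_le_sum fun n hn => ?_
  have hn' : n < 2 ^ (i + 1 + 1) := (Finset.mem_Ico.1 (by simpa [block] using hn)).2
  have hn1 : ((n : ℝ) + 1) ≤ (2 : ℝ) ^ (i + 2) := by
    have : n + 1 ≤ 2 ^ (i + 2) := by simpa [add_assoc] using hn'
    exact_mod_cast this
  calc ∑ χ ∈ Zd.sawFun 2 n e₀, ((pinches i n χ).card : ℝ) * criticalFugacity ^ n
      ≤ ∑ χ ∈ Zd.sawFun 2 n e₀, ((n : ℝ) + 1) * criticalFugacity ^ n := by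
        refine Finset.sum_le_sum fun χ _ => ?_
        gcongr
        exact_mod_cast card_pinches_le i n χ
    _ = ((n : ℝ) + 1) * term n := by
        rw [Finset.sum_const, nsmul_eq_mul, term, ← Zd.card_sawFun]
        ring
    _ ≤ (2 : ℝ) ^ (i + 2) * term n := by
        gcongr
        exact term_nonneg n

/-- **Trivial pinch rarity `π = -1`** (registered sanity sub-goal of the line; the open stub S3 asks
`π = 1/2`): `pinchMass i ≤ 4 · (i+1)^0 · 2^{i} · R_{i+1} + 4 · 2^{-4i}`. [folklore] -/
theorem pinchRarity_neg_one : PinchRarity (-1) := by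
  refine ⟨4, 0, fun i => ?_⟩
  have h1 : ((i : ℝ) + 1) ^ (0 : ℝ) = 1 := Real.rpow_zero _
  have h2 : (2 : ℝ) ^ (-(-1 : ℝ) * (i : ℝ)) = (2 : ℝ) ^ i := by
    rw [neg_neg, one_mul, Real.rpow_natCast]
  rw [h1, h2, mul_one]
  have hR : 0 ≤ blockMass term (i + 1) := blockMass_nonneg term_nonneg _
  have htail : 0 ≤ 4 * (2 : ℝ) ^ (-(4 : ℝ) * (i : ℝ)) := by positivity
  calc pinchMass i ≤ (2 : ℝ) ^ (i + 2) * blockMass term (i + 1) := pinchMass_le_pow_mul_blockMass i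
    _ = 4 * (2 : ℝ) ^ i * blockMass term (i + 1) := by rw [pow_add]; ring
    _ ≤ 4 * (2 : ℝ) ^ i * blockMass term (i + 1) + 4 * (2 : ℝ) ^ (-(4 : ℝ) * (i : ℝ)) :=
        le_add_of_nonneg_right htail

end Summit.CriticalPhenomena.SAWScalingLimit.Theorems.CriticalBubbleBound.Docking

end
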